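import Literature.NumberTheory.GaloisRepresentations.ContinuousCorestriction
import Literature.NumberTheory.EllipticCurves.SubgroupSelmer
import HarnessLib

/-!
# D7-u, file B: refined data from `T`-UNRAMIFIED cocycles — the reduction `ρ̂` (route W2 =
# `KimAtThreeKolyvagin`, crux 19560 (C3) / TamDiv∞; seat `bsd-addord-w2-tamdiv`)

Setting of file A (`KimAtThreeD7uRefinedData`: `G ⊵ U`, `D ≥ I`, `X`, `B ≤ X`) plus a coefficient
map `red : T ⟶ X` (intended: `T_pE → E[M]`) with `red(T^I) ⊆ B`.  A continuous crossed
homomorphism `c : U → T` (an Euler-system class restricted to the level) is UNRAMIFIED ABOVE THE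
PLACE when for every `g ∈ G` there is `s_g ∈ T` with `g⁻¹ c(g τ g⁻¹) = τ s_g − s_g` for all
`τ ∈ I` (binder `hs`; at the prime `g·w̃` the cocycle is a coboundary on the inertia group
`g I g⁻¹ ≤ U`).  Its REFINED REDUCTION is the pair `ρ̂(c, s) = (red ∘ c, g ↦ red(s_g))`.

Results (all cocycle-level identities, no definition): `ρ̂(c, s)` satisfies (L), (C1), (C2) of
file A (`L_mem_rhoHat`, `L_eq_rhoHat`, `C1_rhoHat`, `C2_rhoHat`); two choices of `s` differ by
`B` (`sub_mem_of_data`); a coboundary change of `c` changes `ρ̂` by null data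
(`data_of_coboundary`); the data are compatible with the conjugation action
(`data_conj`, `red_conj`: `ρ̂(g₀ · c, s(g₀⁻¹ ·)) = g₀ · ρ̂(c, s)` on the nose) and with sums
and scalars.  This is what makes `ρ̂` a `G`-EQUIVARIANT additive map from the unramified classes
of `H¹(U, T)` to the refined group of file A, through which the Euler-system relations (which hold
in `H¹(U, T)`) are transported.

References: K. Rubin, *Euler Systems* (2000), §4.6; B. Mazur, K. Rubin, Mem. AMS 799 (2004),
App. A Remark A.5; K. Kato, Astérisque 295 (2004), §8.2 Lemma 8.5 and §13.1 (Kato's classes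
`z_m ∈ H¹(ℤ[ζ_m, 1/p], T)` ARE unramified at every `v ∤ p`).
-/

set_option autoImplicit false
-- the Theorems namespace of a single-conjunct summit repeats the summit name by design (D-0017)
set_option linter.dupNamespace false

noncomputable section

open CategoryTheory Function Finset
open Literature.NumberTheory.GaloisRepresentations
open Literature.NumberTheory.EllipticCurves (subgroupConj subgroupConj_apply_coe)

universe u v

namespace Summit.BirchSwinnertonDyer.BirchSwinnertonDyer.Theorems.KimAtThreeD7uRefined

variable {R : Type v} [CommRing R] [TopologicalSpace R]
variable {G : Type u} [Group G] [TopologicalSpace G] [IsTopologicalGroup G]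
variable (X T : TopRep.{u} R G) (U : Subgroup G) [U.Normal]

/-- Local notation: `𝔠⟦Y, g⟧ z` = the conjugate cocycle `x ↦ g • z(g⁻¹ x g)` on `U`
(coefficients `Y`). -/
local notation3 "𝔠⟦" Y ", " g "⟧" => contOneCocycles.pullback (subgroupConj U g) (conjRepHom Y U g)

/-- Local notation: `𝐫⟦red⟧ c` = the reduced cocycle `red ∘ c` on `U`. -/
local notation3 "𝐫⟦" red "⟧" => contOneCocycles.pullback (ContinuousMonoidHom.id _)
    (X := subgroupRep T U) (Y := subgroupRep X U) ((TopRep.resFunctor (Subgroup.subtype U)).map red)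

/-! ### §1 Reduction of cocycles along `red : T ⟶ X` -/

omit [IsTopologicalGroup G] [U.Normal] in
/-- Values of the reduced cocycle: `(red ∘ c)(x) = red (c x)`. [folklore] -/
theorem red_apply (red : T ⟶ X) (c : contOneCocycles (subgroupRep T U)) (x : U) :
    (𝐫⟦red⟧ c).1 x = red.hom (c.1 x) := rfl

omit [IsTopologicalGroup G] [U.Normal] in
/-- Reduction is additive. [folklore] -/
theorem red_add (red : T ⟶ X) (c c' : contOneCocycles (subgroupRep T U)) :
    𝐫⟦red⟧ (c + c') = 𝐫⟦red⟧ c + 𝐫⟦red⟧ c' := by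
  apply Subtype.ext; ext x
  change red.hom ((c + c').1 x) = red.hom (c.1 x) + red.hom (c'.1 x)
  rw [Submodule.coe_add, ContinuousMap.add_apply, map_add]

omit [IsTopologicalGroup G] [U.Normal] in
/-- Reduction is `R`-linear. [folklore] -/
theorem red_smul (red : T ⟶ X) (a : R) (c : contOneCocycles (subgroupRep T U)) :
    𝐫⟦red⟧ (a • c) = a • 𝐫⟦red⟧ c := by
  apply Subtype.ext; ext x
  change red.hom ((a • c).1 x) = a • red.hom (c.1 x)
  rw [Submodule.coe_smul, ContinuousMap.smul_apply, map_smul]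

/-- **Reduction commutes with the conjugation action**: `red ∘ (g · c) = g · (red ∘ c)`
(`red` is equivariant). [folklore] -/
theorem red_conj (red : T ⟶ X) (g : G) (c : contOneCocycles (subgroupRep T U)) :
    𝐫⟦red⟧ (𝔠⟦T, g⟧ c) = 𝔠⟦X, g⟧ (𝐫⟦red⟧ c) := by
  apply Subtype.ext; ext x
  change red.hom (T.ρ g (c.1 _)) = X.ρ g (red.hom (c.1 _))
  exact TopRep.hom_comm_apply red g _

/-! ### §2 Cocycles of `U` read on `D` through a conjugate: the cochain `δ ↦ g⁻¹ c(g δ g⁻¹)` -/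

omit [IsTopologicalGroup G] [U.Normal] in
/-- The cochain `c^g : δ ↦ g⁻¹ c(g δ g⁻¹)` (on the `δ` with `g δ g⁻¹ ∈ U`) is a crossed
homomorphism: `c^g(δ₁ δ₂) = c^g(δ₁) + δ₁ c^g(δ₂)`. [folklore] -/
theorem conjRes_mul (c : contOneCocycles (subgroupRep T U)) (g δ₁ δ₂ : G)
    (h₁ : g * δ₁ * g⁻¹ ∈ U) (h₂ : g * δ₂ * g⁻¹ ∈ U) (h₁₂ : g * (δ₁ * δ₂) * g⁻¹ ∈ U) :
    T.ρ g⁻¹ (c.1 ⟨g * (δ₁ * δ₂) * g⁻¹, h₁₂⟩) =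
      T.ρ g⁻¹ (c.1 ⟨g * δ₁ * g⁻¹, h₁⟩) + T.ρ δ₁ (T.ρ g⁻¹ (c.1 ⟨g * δ₂ * g⁻¹, h₂⟩)) := by
  have e : (⟨g * (δ₁ * δ₂) * g⁻¹, h₁₂⟩ : U) = ⟨g * δ₁ * g⁻¹, h₁⟩ * ⟨g * δ₂ * g⁻¹, h₂⟩ :=
    Subtype.ext (by change _ = g * δ₁ * g⁻¹ * (g * δ₂ * g⁻¹); group)
  rw [e, subgroup_cocycle_mul T U c, map_add, ← ρ_mul_apply, ← ρ_mul_apply]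
  congr 3
  change g⁻¹ * (g * δ₁ * g⁻¹) = δ₁ * g⁻¹
  group

omit [IsTopologicalGroup G] [U.Normal] in
/-- A crossed homomorphism vanishing on a subgroup `I` normalised by the domain takes `I`-FIXED
values: if `c^g(τ) − (τ s − s) = 0` on `I` then `τ` fixes `c^g(δ) − (δ s − s)` for every `δ`
with `δ I δ⁻¹ = I`. [folklore] -/
theorem conjRes_sub_fixed (c : contOneCocycles (subgroupRep T U)) (g : G) (s : T)
    (I : Subgroup G) (hIU : ∀ τ ∈ I, g * τ * g⁻¹ ∈ U)
    (hs : ∀ (τ : G) (hτ : τ ∈ I), T.ρ g⁻¹ (c.1 ⟨g * τ * g⁻¹, hIU τ hτ⟩) = T.ρ τ s - s)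
    (δ : G) (hδI : ∀ τ ∈ I, δ⁻¹ * τ * δ ∈ I) (hgδ : g * δ * g⁻¹ ∈ U) (τ : G) (hτ : τ ∈ I) :
    T.ρ τ (T.ρ g⁻¹ (c.1 ⟨g * δ * g⁻¹, hgδ⟩) - (T.ρ δ s - s)) =
      T.ρ g⁻¹ (c.1 ⟨g * δ * g⁻¹, hgδ⟩) - (T.ρ δ s - s) := by
  -- `c^g(τ δ) = c^g(τ) + τ c^g(δ)` and `c^g(δ τ') = c^g(δ) + δ c^g(τ')`, `τ δ = δ τ'`
  set τ' := δ⁻¹ * τ * δ with hτ'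
  have hτ'I : τ' ∈ I := hδI τ hτ
  have hτδ : g * (τ * δ) * g⁻¹ ∈ U := by
    have : g * (τ * δ) * g⁻¹ = g * τ * g⁻¹ * (g * δ * g⁻¹) := by group
    rw [this]; exact U.mul_mem (hIU τ hτ) hgδ
  have h1 := conjRes_mul T U c g τ δ (hIU τ hτ) hgδ hτδ
  have hδτ' : g * (δ * τ') * g⁻¹ ∈ U := by
    have : δ * τ' = τ * δ := by rw [hτ']; group
    rw [this]; exact hτδ
  have h2 := conjRes_mul T U c g δ τ' hgδ (hIU τ' hτ'I) hδτ'
  have e : (⟨g * (δ * τ') * g⁻¹, hδτ'⟩ : U) = ⟨g * (τ * δ) * g⁻¹, hτδ⟩ :=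
    Subtype.ext (by change g * (δ * τ') * g⁻¹ = g * (τ * δ) * g⁻¹; rw [hτ']; group)
  rw [e, h1, hs τ hτ, hs τ' hτ'I] at h2
  -- h2 : (τ s - s) + τ c^g(δ) = c^g(δ) + δ (τ' s - s)
  have e2 : T.ρ δ (T.ρ τ' s - s) = T.ρ τ (T.ρ δ s) - T.ρ δ s := by
    rw [map_sub, ← ρ_mul_apply, hτ', show δ * (δ⁻¹ * τ * δ) = τ * δ by group, ρ_mul_apply]
  rw [e2] at h2
  rw [map_sub, map_sub]
  -- from h2: τ c^g(δ) = c^g(δ) + τ δ s - δ s - τ s + s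
  have h3 : T.ρ τ (T.ρ g⁻¹ (c.1 ⟨g * δ * g⁻¹, hgδ⟩)) =
      T.ρ g⁻¹ (c.1 ⟨g * δ * g⁻¹, hgδ⟩) + (T.ρ τ (T.ρ δ s) - T.ρ δ s) - (T.ρ τ s - s) := by
    calc T.ρ τ (T.ρ g⁻¹ (c.1 ⟨g * δ * g⁻¹, hgδ⟩))
        = (T.ρ τ s - s + T.ρ τ (T.ρ g⁻¹ (c.1 ⟨g * δ * g⁻¹, hgδ⟩))) - (T.ρ τ s - s) := by abel
      _ = (T.ρ g⁻¹ (c.1 ⟨g * δ * g⁻¹, hgδ⟩) + (T.ρ τ (T.ρ δ s) - T.ρ δ s)) - (T.ρ τ s - s) := by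
          rw [h2]
      _ = _ := by abel
  rw [h3]
  abel


omit [IsTopologicalGroup G] [U.Normal] in
/-- Conjugating the place by `u ∈ U`: `c^{u g}(τ) = c^g(τ) + (τ − 1) g⁻¹ c(u⁻¹)`. [folklore] -/
theorem conjRes_mul_left_mem (c : contOneCocycles (subgroupRep T U)) (g u τ : G) (hu : u ∈ U)
    (hτ : g * τ * g⁻¹ ∈ U) (hτ' : u * g * τ * (u * g)⁻¹ ∈ U) :
    T.ρ (u * g)⁻¹ (c.1 ⟨u * g * τ * (u * g)⁻¹, hτ'⟩) =
      T.ρ g⁻¹ (c.1 ⟨g * τ * g⁻¹, hτ⟩) + (T.ρ τ (T.ρ g⁻¹ (c.1 ⟨u⁻¹, U.inv_mem hu⟩)) -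
        T.ρ g⁻¹ (c.1 ⟨u⁻¹, U.inv_mem hu⟩)) := by
  have e : (⟨u * g * τ * (u * g)⁻¹, hτ'⟩ : U) =
      ⟨u, hu⟩ * (⟨g * τ * g⁻¹, hτ⟩ * ⟨u⁻¹, U.inv_mem hu⟩) :=
    Subtype.ext (by change u * g * τ * (u * g)⁻¹ = u * (g * τ * g⁻¹ * u⁻¹); group)
  -- `c(u) = -(u • c(u⁻¹))`
  have hinv : c.1 ⟨u, hu⟩ = -(T.ρ u (c.1 ⟨u⁻¹, U.inv_mem hu⟩)) := by
    have h := subgroup_cocycle_inv T U c ⟨u⁻¹, U.inv_mem hu⟩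
    have e3 : (⟨u⁻¹, U.inv_mem hu⟩ : U)⁻¹ = ⟨u, hu⟩ := Subtype.ext (by change u⁻¹⁻¹ = u; rw [inv_inv])
    rw [e3] at h
    rw [h]
    change -(T.ρ u⁻¹⁻¹ _) = _
    rw [inv_inv]
  rw [e, subgroup_cocycle_mul T U c, subgroup_cocycle_mul T U c, hinv]
  change T.ρ (u * g)⁻¹ (-(T.ρ u (c.1 ⟨u⁻¹, U.inv_mem hu⟩)) +
      T.ρ u (c.1 ⟨g * τ * g⁻¹, hτ⟩ + T.ρ (g * τ * g⁻¹) (c.1 ⟨u⁻¹, U.inv_mem hu⟩))) = _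
  simp only [map_add, map_neg, ← ρ_mul_apply]
  rw [show (u * g)⁻¹ * u = g⁻¹ by group, show (u * g)⁻¹ * (u * (g * τ * g⁻¹)) = τ * g⁻¹ by group,
    ρ_mul_apply]
  abel

/-! ### §3 The refined reduction `ρ̂(c, s) = (red ∘ c, g ↦ red (s g))` of an unramified cocycle -/

section RhoHat

variable (B : Submodule R X) (D I : Subgroup G) (red : T ⟶ X)
variable (hIU : ∀ (g τ : G), τ ∈ I → g * τ * g⁻¹ ∈ U)

omit [IsTopologicalGroup G] [U.Normal] in
/-- **(L), `B`-part, for `ρ̂`**: `g⁻¹ red(c(gδg⁻¹)) − (δ red(s_g) − red(s_g)) ∈ B` — it is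
`red` of the `I`-fixed vector `c^g(δ) − (δ s_g − s_g)` (`conjRes_sub_fixed`), and
`red(T^I) ⊆ B`. [folklore] -/
theorem L_mem_rhoHat (hID : ∀ δ ∈ D, ∀ τ ∈ I, δ⁻¹ * τ * δ ∈ I)
    (hB : ∀ t : T, (∀ τ ∈ I, T.ρ τ t = t) → red.hom t ∈ B)
    (c : contOneCocycles (subgroupRep T U)) (s : G → T)
    (hs : ∀ (g τ : G) (hτ : τ ∈ I), T.ρ g⁻¹ (c.1 ⟨g * τ * g⁻¹, hIU g τ hτ⟩) = T.ρ τ (s g) - s g)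
    (g δ : G) (hδ : δ ∈ D) (hgδ : g * δ * g⁻¹ ∈ U) :
    X.ρ g⁻¹ ((𝐫⟦red⟧ c).1 ⟨g * δ * g⁻¹, hgδ⟩) - (X.ρ δ (red.hom (s g)) - red.hom (s g)) ∈ B := by
  have e : X.ρ g⁻¹ ((𝐫⟦red⟧ c).1 ⟨g * δ * g⁻¹, hgδ⟩) - (X.ρ δ (red.hom (s g)) - red.hom (s g)) =
      red.hom (T.ρ g⁻¹ (c.1 ⟨g * δ * g⁻¹, hgδ⟩) - (T.ρ δ (s g) - s g)) := by
    rw [red_apply, map_sub, map_sub, TopRep.hom_comm_apply, TopRep.hom_comm_apply]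
  rw [e]
  exact hB _ fun τ hτ => conjRes_sub_fixed T U c g (s g) I (hIU g) (hs g) δ (hID δ hδ) hgδ τ hτ

omit [IsTopologicalGroup G] [U.Normal] in
/-- **(L), `I`-part, for `ρ̂`**: `g⁻¹ red(c(gτg⁻¹)) − (τ red(s_g) − red(s_g)) = 0` for `τ ∈ I`.
[folklore] -/
theorem L_eq_rhoHat (c : contOneCocycles (subgroupRep T U)) (s : G → T)
    (hs : ∀ (g τ : G) (hτ : τ ∈ I), T.ρ g⁻¹ (c.1 ⟨g * τ * g⁻¹, hIU g τ hτ⟩) = T.ρ τ (s g) - s g)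
    (g τ : G) (hτ : τ ∈ I) :
    X.ρ g⁻¹ ((𝐫⟦red⟧ c).1 ⟨g * τ * g⁻¹, hIU g τ hτ⟩) - (X.ρ τ (red.hom (s g)) - red.hom (s g)) = 0 := by
  rw [red_apply, ← TopRep.hom_comm_apply, hs g τ hτ, map_sub, TopRep.hom_comm_apply, sub_self]

omit [IsTopologicalGroup G] [U.Normal] in
/-- **(C1) for `ρ̂`**: `red(s_{ug}) − red(s_g) − g⁻¹ red(c(u⁻¹)) ∈ B` for `u ∈ U`
(`conjRes_mul_left_mem`: `s_{ug} − s_g − g⁻¹ c(u⁻¹)` is `I`-fixed). [folklore] -/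
theorem C1_rhoHat (hB : ∀ t : T, (∀ τ ∈ I, T.ρ τ t = t) → red.hom t ∈ B)
    (c : contOneCocycles (subgroupRep T U)) (s : G → T)
    (hs : ∀ (g τ : G) (hτ : τ ∈ I), T.ρ g⁻¹ (c.1 ⟨g * τ * g⁻¹, hIU g τ hτ⟩) = T.ρ τ (s g) - s g)
    (u : G) (hu : u ∈ U) (g : G) :
    red.hom (s (u * g)) - red.hom (s g) - X.ρ g⁻¹ ((𝐫⟦red⟧ c).1 ⟨u⁻¹, U.inv_mem hu⟩) ∈ B := by
  have e : red.hom (s (u * g)) - red.hom (s g) - X.ρ g⁻¹ ((𝐫⟦red⟧ c).1 ⟨u⁻¹, U.inv_mem hu⟩) =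
      red.hom (s (u * g) - s g - T.ρ g⁻¹ (c.1 ⟨u⁻¹, U.inv_mem hu⟩)) := by
    rw [red_apply, map_sub, map_sub, TopRep.hom_comm_apply]
  rw [e]
  refine hB _ fun τ hτ => ?_
  have h1 := hs (u * g) τ hτ
  rw [conjRes_mul_left_mem T U c g u τ hu (hIU g τ hτ), hs g τ hτ] at h1
  -- h1 : (τ s_g - s_g) + (τ g⁻¹c(u⁻¹) - g⁻¹c(u⁻¹)) = τ s_{ug} - s_{ug}
  rw [map_sub, map_sub]
  have h2 : T.ρ τ (s (u * g)) = s (u * g) + (T.ρ τ (s g) - s g) +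
      (T.ρ τ (T.ρ g⁻¹ (c.1 ⟨u⁻¹, U.inv_mem hu⟩)) - T.ρ g⁻¹ (c.1 ⟨u⁻¹, U.inv_mem hu⟩)) := by
    rw [add_assoc, h1]; abel
  rw [h2]
  abel

omit [IsTopologicalGroup G] [U.Normal] in
/-- **(C2) for `ρ̂`**: `red(s_{gδ}) − δ⁻¹ red(s_g) ∈ B` for `δ ∈ D` (`I` is normalised by `D`).
[folklore] -/
theorem C2_rhoHat (hID : ∀ δ ∈ D, ∀ τ ∈ I, δ⁻¹ * τ * δ ∈ I)
    (hB : ∀ t : T, (∀ τ ∈ I, T.ρ τ t = t) → red.hom t ∈ B)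
    (c : contOneCocycles (subgroupRep T U)) (s : G → T)
    (hs : ∀ (g τ : G) (hτ : τ ∈ I), T.ρ g⁻¹ (c.1 ⟨g * τ * g⁻¹, hIU g τ hτ⟩) = T.ρ τ (s g) - s g)
    (g δ : G) (hδ : δ ∈ D) :
    red.hom (s (g * δ)) - X.ρ δ⁻¹ (red.hom (s g)) ∈ B := by
  rw [← TopRep.hom_comm_apply, ← map_sub]
  refine hB _ fun τ hτ => ?_
  -- `τ' = δ τ δ⁻¹ ∈ I`
  have hτ' : δ * τ * δ⁻¹ ∈ I := by
    have := hID δ⁻¹ (D.inv_mem hδ) τ hτ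
    rwa [inv_inv] at this
  have h1 := hs (g * δ) τ hτ
  have h2 := hs g (δ * τ * δ⁻¹) hτ'
  have e : (⟨g * δ * τ * (g * δ)⁻¹, hIU (g * δ) τ hτ⟩ : U) =
      ⟨g * (δ * τ * δ⁻¹) * g⁻¹, hIU g _ hτ'⟩ :=
    Subtype.ext (by change g * δ * τ * (g * δ)⁻¹ = g * (δ * τ * δ⁻¹) * g⁻¹; group)
  rw [e, mul_inv_rev, ρ_mul_apply, h2, map_sub, ← ρ_mul_apply,
    show δ⁻¹ * (δ * τ * δ⁻¹) = τ * δ⁻¹ by group, ρ_mul_apply] at h1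
  -- h1 : τ (δ⁻¹ s_g) - δ⁻¹ s_g = τ s_{gδ} - s_{gδ}
  rw [map_sub]
  have h3 : T.ρ τ (s (g * δ)) = s (g * δ) + (T.ρ τ (T.ρ δ⁻¹ (s g)) - T.ρ δ⁻¹ (s g)) := by
    rw [h1]; abel
  rw [h3]
  abel

omit [IsTopologicalGroup G] [U.Normal] in
/-- **Two unramified trivialisations differ by `B`** (after `red`): `red(s_g) − red(s'_g) ∈ B`.
[folklore] -/
theorem sub_mem_of_data (hB : ∀ t : T, (∀ τ ∈ I, T.ρ τ t = t) → red.hom t ∈ B)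
    (c : contOneCocycles (subgroupRep T U)) (s s' : G → T)
    (hs : ∀ (g τ : G) (hτ : τ ∈ I), T.ρ g⁻¹ (c.1 ⟨g * τ * g⁻¹, hIU g τ hτ⟩) = T.ρ τ (s g) - s g)
    (hs' : ∀ (g τ : G) (hτ : τ ∈ I), T.ρ g⁻¹ (c.1 ⟨g * τ * g⁻¹, hIU g τ hτ⟩) = T.ρ τ (s' g) - s' g)
    (g : G) : red.hom (s g) - red.hom (s' g) ∈ B := by
  rw [← map_sub]
  refine hB _ fun τ hτ => ?_
  have h := (hs g τ hτ).symm.trans (hs' g τ hτ)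
  rw [map_sub]
  rw [sub_eq_sub_iff_sub_eq_sub] at h
  rw [h]

omit [IsTopologicalGroup G] [U.Normal] in
/-- **Coboundary change**: if `c' = c + dθ` and `s` trivialises `c`, then `s + (g ↦ g⁻¹ θ)`
trivialises `c'`. [folklore] -/
theorem data_of_coboundary (c c' : contOneCocycles (subgroupRep T U)) (θ : T)
    (hc' : ∀ x : U, c'.1 x = c.1 x + (T.ρ (x : G) θ - θ)) (s : G → T)
    (hs : ∀ (g τ : G) (hτ : τ ∈ I), T.ρ g⁻¹ (c.1 ⟨g * τ * g⁻¹, hIU g τ hτ⟩) = T.ρ τ (s g) - s g)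
    (g τ : G) (hτ : τ ∈ I) :
    T.ρ g⁻¹ (c'.1 ⟨g * τ * g⁻¹, hIU g τ hτ⟩) = T.ρ τ (s g + T.ρ g⁻¹ θ) - (s g + T.ρ g⁻¹ θ) := by
  rw [hc', map_add, hs g τ hτ, Subgroup.coe_mk, map_sub, map_add, ← ρ_mul_apply, ← ρ_mul_apply,
    show g⁻¹ * (g * τ * g⁻¹) = τ * g⁻¹ by group]
  abel

omit [IsTopologicalGroup G] [U.Normal] in
/-- The reduced cocycles of `c' = c + dθ` and `c` differ by `d(red θ)`. [folklore] -/
theorem red_of_coboundary (c c' : contOneCocycles (subgroupRep T U)) (θ : T)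
    (hc' : ∀ x : U, c'.1 x = c.1 x + (T.ρ (x : G) θ - θ)) (x : U) :
    (𝐫⟦red⟧ c' - 𝐫⟦red⟧ c).1 x = X.ρ (x : G) (red.hom θ) - red.hom θ := by
  rw [Submodule.coe_sub, ContinuousMap.sub_apply, red_apply, red_apply, hc', map_add, map_sub,
    TopRep.hom_comm_apply]
  abel

omit [TopologicalSpace G] [IsTopologicalGroup G] [U.Normal] in
/-- The `η`-parts of `ρ̂(c + dθ, s + (· )⁻¹θ)` and `ρ̂(c, s)` differ by `g⁻¹ red(θ)` exactly. [folklore] -/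
theorem eta_of_coboundary (θ : T) (s : G → T) (g : G) :
    red.hom (s g + T.ρ g⁻¹ θ) - red.hom (s g) - X.ρ g⁻¹ (red.hom θ) ∈ B := by
  rw [map_add, TopRep.hom_comm_apply]
  simp

/-- **Compatibility with the conjugation action**: if `s` trivialises `c` then `s(g₀⁻¹ ·)`
trivialises `g₀ · c` (so `ρ̂(g₀ · c, s(g₀⁻¹ ·)) = g₀ · ρ̂(c, s)` on the nose, with `red_conj`).
[folklore] -/
theorem data_conj (c : contOneCocycles (subgroupRep T U)) (s : G → T)
    (hs : ∀ (g τ : G) (hτ : τ ∈ I), T.ρ g⁻¹ (c.1 ⟨g * τ * g⁻¹, hIU g τ hτ⟩) = T.ρ τ (s g) - s g)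
    (g₀ g τ : G) (hτ : τ ∈ I) :
    T.ρ g⁻¹ ((𝔠⟦T, g₀⟧ c).1 ⟨g * τ * g⁻¹, hIU g τ hτ⟩) = T.ρ τ (s (g₀⁻¹ * g)) - s (g₀⁻¹ * g) := by
  rw [← hs (g₀⁻¹ * g) τ hτ]
  change T.ρ g⁻¹ (T.ρ g₀ (c.1 _)) = _
  rw [← ρ_mul_apply]
  congr 1
  · rw [mul_inv_rev, inv_inv]
  · exact congrArg _ (Subtype.ext (by change g₀⁻¹ * _ * g₀ = _; group))

omit [IsTopologicalGroup G] [U.Normal] in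
/-- Trivialisations add. [folklore] -/
theorem data_add (c c' : contOneCocycles (subgroupRep T U)) (s s' : G → T)
    (hs : ∀ (g τ : G) (hτ : τ ∈ I), T.ρ g⁻¹ (c.1 ⟨g * τ * g⁻¹, hIU g τ hτ⟩) = T.ρ τ (s g) - s g)
    (hs' : ∀ (g τ : G) (hτ : τ ∈ I), T.ρ g⁻¹ (c'.1 ⟨g * τ * g⁻¹, hIU g τ hτ⟩) = T.ρ τ (s' g) - s' g)
    (g τ : G) (hτ : τ ∈ I) :
    T.ρ g⁻¹ ((c + c').1 ⟨g * τ * g⁻¹, hIU g τ hτ⟩) = T.ρ τ ((s + s') g) - (s + s') g := by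
  rw [Submodule.coe_add, ContinuousMap.add_apply, map_add, hs g τ hτ, hs' g τ hτ, Pi.add_apply,
    map_add]
  abel

omit [IsTopologicalGroup G] [U.Normal] in
/-- Trivialisations scale. [folklore] -/
theorem data_smul (c : contOneCocycles (subgroupRep T U)) (s : G → T) (a : R)
    (hs : ∀ (g τ : G) (hτ : τ ∈ I), T.ρ g⁻¹ (c.1 ⟨g * τ * g⁻¹, hIU g τ hτ⟩) = T.ρ τ (s g) - s g)
    (g τ : G) (hτ : τ ∈ I) :
    T.ρ g⁻¹ ((a • c).1 ⟨g * τ * g⁻¹, hIU g τ hτ⟩) = T.ρ τ ((a • s) g) - (a • s) g := by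
  rw [Submodule.coe_smul, ContinuousMap.smul_apply, map_smul, hs g τ hτ, Pi.smul_apply, map_smul,
    smul_sub]

omit [IsTopologicalGroup G] [U.Normal] in
/-- **From unramifiedness at every prime above the place to a trivialisation**: if at each
conjugate `g I g⁻¹` the cocycle `c` is a coboundary (`c(gτg⁻¹) = (gτg⁻¹) S − S`), then
`s_g = g⁻¹ S` trivialises `c^g` on `I`. [folklore] -/
theorem exists_data_of_unramified (c : contOneCocycles (subgroupRep T U))
    (hunr : ∀ g : G, ∃ S : T, ∀ (τ : G) (hτ : τ ∈ I),
      c.1 ⟨g * τ * g⁻¹, hIU g τ hτ⟩ = T.ρ (g * τ * g⁻¹) S - S) :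
    ∃ s : G → T, ∀ (g τ : G) (hτ : τ ∈ I),
      T.ρ g⁻¹ (c.1 ⟨g * τ * g⁻¹, hIU g τ hτ⟩) = T.ρ τ (s g) - s g := by
  choose S hS using hunr
  refine ⟨fun g => T.ρ g⁻¹ (S g), fun g τ hτ => ?_⟩
  rw [hS g τ hτ, map_sub, ← ρ_mul_apply, ← ρ_mul_apply,
    show g⁻¹ * (g * τ * g⁻¹) = τ * g⁻¹ by group]

end RhoHat

end Summit.BirchSwinnertonDyer.BirchSwinnertonDyer.Theorems.KimAtThreeD7uRefined

end
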